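import Literature.NumberTheory.NumberFields.CMFieldRelativeClassNumberOddDegree
import Mathlib.FieldTheory.KrullTopology
import HarnessLib

/-!
# The norm map `C_K/ιC_{K⁺} → C_k/ιC_{k⁺}` of CM fields and Okazaki's Corollary 28:
# `h⁻_k κ_k ∣ 2^r h⁻_K κ_K`, and `h⁻_k ∣ 4h⁻_K` when `K` contains at most one quadratic extension of `k`
# — in particular Theorem 1 `h⁻_k ∣ 4h⁻_K` for `[K : k] = 2` and for `K/k` cyclic (Okazaki, *Acta Arith.* 92 (2000),
# §5 (4), Prop. 27, Cor. 28; Thm. 1, Cor. 2)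

Topic `NumberTheory/NumberFields` (class field theory); namespace `Literature.NumberTheory.NumberFields`.
Theorem-only file (no definition, no named fact, no `sorry`), unconditional.  Sequel of
`CMFieldRelativeClassNumberOddDegree.lean` (Cor. 29; formula (4) `[C_F : ι(C_{F⁺})] = h⁻_F κ_F`) and of
`CMFieldNormCokernelExponentTwo.lean` (Prop. 27: `c² ∈ S := N_{L/K}(C_L)·ι(C_{K⁺})` for every class `c`
of `K`; the class field of any `S' ⊇ N_{L/K}(C_L)` embeds into `L` over `K`).

> Okazaki, §5: "It is obvious that (4) `h⁻_F = #(C_F/ιC_{F⁺})/κ_F`."  **Proposition 27.** "Let `k ⊂ K`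
> be two CM-fields.  Then the exponent of `coker(N : C_K/ιC_{K⁺} → C_k/ιC_{k⁺})` divides `2`."
> **Corollary 28.** "Let `k ⊂ K` be two CM-fields.  Assume that `K` contains at most one quadratic
> extension of `k`.  Then `h⁻_k ∣ 4h⁻_K`.  Assume further that `κ_K ∣ κ_k`.  Then `h⁻_k ∣ 2h⁻_K`.
> *Proof.* Let `r` be the `2`-rank of the cokernel in Proposition 27.  Then `#(C_k/ιC_{k⁺})/2^r`
> divides `#(C_K/ιC_{K⁺})` by (4), i.e., `h⁻_k` divides `2^r h⁻_K κ_K/κ_k`.  The assumption of the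
> lemma implies `r ≤ 1` by class field theory.  The desired assertions follow immediately from
> Lemma 14."

We write `(K, L)` for Okazaki's `(k, K)`; `C_F = Cl(𝓞 F)`, `ι_F = classGroupExtend F⁺ F`,
`N = classGroupNorm K L`, `κ_F = #ker ι_F`, `h⁻_F = h_F/h_{F⁺}`, `S = N(C_L) ⊔ ι_K(C_{K⁺})`.

1. (§1) **The norm map `C_L/ι_L(C_{L⁺}) → C_K/ι_K(C_{K⁺})` is well defined**, i.e.
   `N(ι_L(C_{L⁺})) ⊆ ι_K(C_{K⁺})` — from the base change of the relative ideal norm along the CM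
   square `K⁺ ⊆ L⁺`, `K ⊆ L`: **`N_{L/K}(𝔟𝓞_L) = (N_{L⁺/K⁺}𝔟)𝓞_K`** for ideals `𝔟 ⊆ 𝓞_{L⁺}` (both
   `𝔄 = N_{L/K}(𝔟𝓞_L)` and `𝔟𝓞_L` are conjugation-stable, so `𝔄² = 𝔄𝔄̄ = N_{K/K⁺}(𝔄)𝓞_K` and
   `N_{L/L⁺}(𝔟𝓞_L) = 𝔟²`; by transitivity `N_{K/K⁺}(𝔄) = N_{L⁺/K⁺}(𝔟)²`; unique square roots).
2. (§2) **`[C_K : ι_K(C_{K⁺})] ∣ [C_K : S] · [C_L : ι_L(C_{L⁺})]`** (`N` induces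
   `C_L/ι_L(C_{L⁺}) ↠ S/ι_K(C_{K⁺})`), hence by (4) **`h⁻_K κ_K ∣ [C_K : S] · h⁻_L κ_L`**, and
   `[C_K : S] = 2^r` (Prop. 27: `C_K/S` has exponent `2`) — Okazaki's «`h⁻_k` divides
   `2^r h⁻_K κ_K/κ_k`».
3. (§3) «`r ≤ 1` by class field theory»: if `L` contains at most one quadratic extension of `K`
   then `[C_K : S] ∣ 2` — otherwise `C_K` has two distinct subgroups `M₁, M₂ ⊇ S` of index `2` (a
   finite abelian group all of whose squares lie in `S`), whose class fields are two distinct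
   quadratic extensions of `K` inside the Hilbert class field, both embedding into `L` (norm
   limitation), with distinct images (they are normal over `K`).
4. (§4) **Corollary 28: `h⁻_K ∣ 4 h⁻_L`, and `h⁻_K ∣ 2 h⁻_L` if `κ_L ∣ κ_K`** (Lemma 14: `κ_F ≤ 2`).
5. (§5, appended) **Theorem 1 («Let `k ⊂ K` be two CM-fields.  Then `h⁻_k ∣ 4h⁻_K`») in the case `[K : k] = 2`**
   (a quadratic extension contains exactly one quadratic subextension of its base):
   `IsCMField.classNumber_div_dvd_four_mul_of_finrank_eq_two`, `…_dvd_two_mul_of_finrank_eq_two`; for an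
   imaginary quadratic `k` inside a quartic CM field `K`: `h_k ∣ 4h⁻_K`
   (`IsCMField.classNumber_dvd_four_mul_classNumber_div_of_finrank_eq_two`) and **Corollary 2 («`h_k = 1, 2` or
   `4`» when `h⁻_K = 1`) in the case `[K : ℚ] = 4`** (`IsCMField.classNumber_eq_of_finrank_eq_two_of_classNumber_div_eq_one`).
6. (§6, appended) **Theorem 1 for CYCLIC Galois extensions `K/k` of CM fields, any degree**
   (`IsCMField.classNumber_div_dvd_four_mul_of_isCyclic`, `…_dvd_two_mul_of_isCyclic`): a finite cyclic group has at
   most one subgroup of index `2` (`Subgroup.eq_of_index_eq_two_of_isCyclic`), so by the Galois correspondence a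
   cyclic extension has at most one quadratic subextension (`IntermediateField.eq_of_finrank_eq_two_of_isCyclic`).
   Theorem 1 in general (Thm. 30, Props. 22–23: Hilbert class fields) is NOT typed.

## Main results (`K L : Type` CM number fields, `L` a `K`-algebra)

* `IsCMField.relNorm_map_eq_map_relNorm` — `N_{L/K}(𝔟𝓞_L) = (N_{L⁺/K⁺}𝔟)𝓞_K` for `𝔟 ⊆ 𝓞_{L⁺}` (any
  algebra `K⁺ → L⁺` compatible with `K → L`); `IsCMField.classGroupNorm_classGroupExtend_eq` — on classes;
  **`IsCMField.map_range_classGroupExtend_le`** — `N(ι_L(C_{L⁺})) ⊆ ι_K(C_{K⁺})`.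
* **`IsCMField.index_range_classGroupExtend_dvd`** — `[C_K : ι_K C_{K⁺}] ∣ [C_K : S]·[C_L : ι_L C_{L⁺}]`;
  **`IsCMField.classNumber_div_mul_card_ker_dvd`** — `h⁻_K κ_K ∣ [C_K : S] · h⁻_L κ_L`;
  `IsCMField.exists_index_range_sup_range_eq_two_pow` — `[C_K : S] = 2^r`.
* `Subgroup.exists_index_two_not_mem_of_sq_mem` — a finite abelian group with all squares in `A ∌ t`
  has an index-`2` subgroup `M ⊇ A`, `t ∉ M`.
* **`IsCMField.index_range_sup_range_dvd_two`** — at most one quadratic `K ⊆ E ⊆ L` ⟹ `[C_K : S] ∣ 2`.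
* **`IsCMField.classNumber_div_dvd_four_mul`**, **`IsCMField.classNumber_div_dvd_two_mul`** — Cor. 28.

Honest column: the hypothesis «`K` contains at most one quadratic extension of `k`» is rendered as:
any two intermediate fields of `L/K` of degree `2` over `K` are equal.  The `2`-rank `r` appears as the
exponent with `[C_K : S] = 2^r`.  The algebra `K⁺ → L⁺` (restriction of `K → L`) is an arbitrary
compatible instance in §1's first two statements and is built locally elsewhere.

## References

* R. Okazaki, *Inclusion of CM-fields and divisibility of relative class numbers*, Acta Arith. 92 (2000)
  319–338, §3 Lemma 14, §5 (4), Prop. 27, Cor. 28 and the Remark after it; §1 Theorem 1, Corollary 2; §7 proof of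
  Theorem 1 (held `paper:doi-10-4064-aa-92-4-319-338`, pp. 1–2, 12–14, 18). [Okazaki2000]
* J. Neukirch, *Algebraic Number Theory*, Grundlehren 322 (1999), Ch. III §1 Prop. (1.6), Ch. VI §6–§7.
  [NeukirchANT1999]
* D. A. Cox, *Primes of the form x² + ny²*, 2nd ed. (2013), §5.C Cor. 5.24. [Cox2013]
* L. C. Washington, *Introduction to Cyclotomic Fields*, 2nd ed. (1997), Thms. 10.1, 10.3. [Washington1997]
-/

noncomputable section

open NumberField NumberField.IsCMField IsDedekindDomain
open scoped nonZeroDivisors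

namespace Literature.NumberTheory.NumberFields

/-! ### §1. Base change of the relative norm: `N_{L/K}(𝔟𝓞_L) = (N_{L⁺/K⁺}𝔟)𝓞_K` -/

section BaseChange

variable (K L : Type) [Field K] [NumberField K] [IsCMField K] [Field L] [NumberField L] [IsCMField L]
  [Algebra K L]

omit [IsCMField L] [Algebra K L] in
/-- Extension of ideals `𝓞 L⁺ → 𝓞 L` is injective (Dedekind domains). [folklore] -/
private theorem map_ringOfIntegers_injective :
    Function.Injective
      (Ideal.map (algebraMap (𝓞 (maximalRealSubfield L)) (𝓞 L)) :
        Ideal (𝓞 (maximalRealSubfield L)) → Ideal (𝓞 L)) := by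
  intro I J h
  have hinj := FractionalIdeal.extendedHom_injective (𝓞 (maximalRealSubfield L)) (maximalRealSubfield L)
    (L := L) (B := 𝓞 L)
  have h' : FractionalIdeal.extendedHom L (𝓞 L)
      ((I : FractionalIdeal (𝓞 (maximalRealSubfield L))⁰ (maximalRealSubfield L))) =
      FractionalIdeal.extendedHom L (𝓞 L)
      ((J : FractionalIdeal (𝓞 (maximalRealSubfield L))⁰ (maximalRealSubfield L))) := by
    rw [FractionalIdeal.extendedHom_coeIdeal_eq_map, FractionalIdeal.extendedHom_coeIdeal_eq_map, h]
  exact FractionalIdeal.coeIdeal_injective (hinj h')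

/-- In a Dedekind domain, `I² = J² ⟹ I = J` for ideals. [folklore] -/
private theorem ideal_eq_of_sq_eq {R : Type*} [CommRing R] [IsDedekindDomain R] {I J : Ideal R}
    (h : I ^ 2 = J ^ 2) : I = J := by
  classical
  by_cases hI : I = ⊥
  · subst hI
    rw [Ideal.zero_eq_bot.symm, zero_pow two_ne_zero, eq_comm, pow_eq_zero_iff two_ne_zero] at h
    exact h.symm
  by_cases hJ : J = ⊥
  · subst hJ
    rw [Ideal.zero_eq_bot.symm, zero_pow two_ne_zero, pow_eq_zero_iff two_ne_zero] at h
    exact h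
  have key : UniqueFactorizationMonoid.normalizedFactors I =
      UniqueFactorizationMonoid.normalizedFactors J := by
    have h2 := congrArg UniqueFactorizationMonoid.normalizedFactors h
    rw [UniqueFactorizationMonoid.normalizedFactors_pow, UniqueFactorizationMonoid.normalizedFactors_pow]
      at h2
    ext p
    have h3 := congrArg (Multiset.count p) h2
    simp only [Multiset.count_nsmul] at h3
    omega
  exact associated_iff_eq.mp
    ((UniqueFactorizationMonoid.associated_iff_normalizedFactors_eq_normalizedFactors hI hJ).mpr key)

omit [IsCMField K] [Algebra K L] in
/-- The extension `𝔟𝓞_L` of an ideal of `𝓞 L⁺` is stable under complex conjugation. [folklore] -/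
private theorem map_conj_map_eq (𝔟 : Ideal (𝓞 (maximalRealSubfield L))) :
    (𝔟.map (algebraMap (𝓞 (maximalRealSubfield L)) (𝓞 L))).map
        (RingOfIntegers.mapAlgEquiv (complexConj L)) =
      𝔟.map (algebraMap (𝓞 (maximalRealSubfield L)) (𝓞 L)) := by
  rw [← Ideal.map_coe (RingOfIntegers.mapAlgEquiv (complexConj L)), Ideal.map_map]
  congr 1
  exact RingHom.ext fun x => (ringOfIntegersComplexConj L).commutes x

omit [NumberField L] [IsCMField L] [IsCMField K] [NumberField K] [Algebra K L] in
/-- The two integer models of an automorphism give the same image ideals: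
`𝔄.map (AmbiguousClass.intAut σ) = 𝔄.map (RingOfIntegers.mapAlgEquiv σ)`. [folklore] -/
private theorem map_intAut_eq {F : Type*} [Field F] [Algebra F L] (σ : L ≃ₐ[F] L) (J : Ideal (𝓞 L)) :
    J.map (AmbiguousClass.intAut σ : 𝓞 L →+* 𝓞 L) = J.map (RingOfIntegers.mapAlgEquiv σ) := by
  unfold Ideal.map
  exact congrArg Ideal.span (Set.image_congr fun x _ => RingOfIntegers.ext rfl)

/-- **Base change of the relative ideal norm along the CM square: `N_{L/K}(𝔟𝓞_L) = (N_{L⁺/K⁺}𝔟)𝓞_K`**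
for every ideal `𝔟` of `𝓞_{L⁺}` and CM fields `K ⊆ L` (any algebra `K⁺ → L⁺` compatible with `K → L`).
Proof: `𝔅 = 𝔟𝓞_L` and `𝔄 = N_{L/K}(𝔅)` are conjugation-stable (`N_{L/K}` is conjugation-equivariant, the
complex conjugation of `L` restricting to that of `K`), so by Neukirch (1.6)(iv) in the quadratic
layers `𝔄² = N_{K/K⁺}(𝔄)𝓞_K` and `N_{L/L⁺}(𝔅) = 𝔟²`; by transitivity
`N_{K/K⁺}(𝔄) = N_{L/K⁺}(𝔅) = N_{L⁺/K⁺}(𝔟)²`; hence `𝔄² = ((N_{L⁺/K⁺}𝔟)𝓞_K)²` and `𝔄 = (N_{L⁺/K⁺}𝔟)𝓞_K`.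
This is the well-definedness of Okazaki's `N : C_K/ιC_{K⁺} → C_k/ιC_{k⁺}`.
[cite: Okazaki2000, §5 Prop. 27 (the map `N : C_K/ιC_{K⁺} → C_k/ιC_{k⁺}`)] [cite: NeukirchANT1999, Ch. III §1 Prop. (1.6) (i), (iv)] -/
theorem IsCMField.relNorm_map_eq_map_relNorm [Algebra (maximalRealSubfield K) (maximalRealSubfield L)]
    [IsScalarTower (maximalRealSubfield K) (maximalRealSubfield L) L]
    (𝔟 : Ideal (𝓞 (maximalRealSubfield L))) :
    Ideal.relNorm (𝓞 K) (𝔟.map (algebraMap (𝓞 (maximalRealSubfield L)) (𝓞 L))) =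
      (Ideal.relNorm (𝓞 (maximalRealSubfield K)) 𝔟).map
        (algebraMap (𝓞 (maximalRealSubfield K)) (𝓞 K)) := by
  have h2K : Module.finrank (maximalRealSubfield K) K = 2 :=
    Algebra.IsQuadraticExtension.finrank_eq_two (maximalRealSubfield K) K
  have h2L : Module.finrank (maximalRealSubfield L) L = 2 :=
    Algebra.IsQuadraticExtension.finrank_eq_two (maximalRealSubfield L) L
  set 𝔅 : Ideal (𝓞 L) := 𝔟.map (algebraMap (𝓞 (maximalRealSubfield L)) (𝓞 L)) with h𝔅def
  set 𝔄 : Ideal (𝓞 K) := Ideal.relNorm (𝓞 K) 𝔅 with h𝔄def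
  -- (1) `𝔅` and `𝔄` are conjugation-stable
  have h𝔅 : 𝔅.map (RingOfIntegers.mapAlgEquiv (complexConj L)) = 𝔅 := map_conj_map_eq L 𝔟
  have h𝔄 : 𝔄.map (RingOfIntegers.mapAlgEquiv (complexConj K)) = 𝔄 := by
    have h := relNorm_map_intAut_eq K L (complexConj L) (complexConj K)
      (fun x => (algebraMap_complexConj x).symm) 𝔅
    rw [map_intAut_eq, map_intAut_eq, h𝔅] at h
    rw [h𝔄def, ← h]
  -- (2) `𝔄² = N_{K/K⁺}(𝔄)𝓞_K`
  have h3 := NumberField.mul_map_eq_map_relNorm_of_finrank_eq_two (maximalRealSubfield K) K h2K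
    (complexConj K) (complexConj_ne_one K) 𝔄
  rw [h𝔄, ← pow_two] at h3
  -- (3) `N_{K/K⁺}(𝔄) = N_{L⁺/K⁺}(N_{L/L⁺}(𝔅))` (both are `N_{L/K⁺}(𝔅)`)
  have h4 : Ideal.relNorm (𝓞 (maximalRealSubfield K)) 𝔄 =
      Ideal.relNorm (𝓞 (maximalRealSubfield K)) (Ideal.relNorm (𝓞 (maximalRealSubfield L)) 𝔅) := by
    rw [h𝔄def, Ideal.relNorm_relNorm, Ideal.relNorm_relNorm]
  -- (4) `N_{L/L⁺}(𝔅) = 𝔟²`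
  have h5 : Ideal.relNorm (𝓞 (maximalRealSubfield L)) 𝔅 = 𝔟 ^ 2 := by
    apply map_ringOfIntegers_injective L
    have h := NumberField.mul_map_eq_map_relNorm_of_finrank_eq_two (maximalRealSubfield L) L h2L
      (complexConj L) (complexConj_ne_one L) 𝔅
    rw [h𝔅, ← pow_two] at h
    rw [← h, Ideal.map_pow]
  -- (5) `𝔄² = ((N_{L⁺/K⁺}𝔟)𝓞_K)²`
  apply ideal_eq_of_sq_eq
  rw [h3, h4, h5, map_pow, Ideal.map_pow]

/-- **`N_{L/K}(ι_L c) = ι_K(N_{L⁺/K⁺} c)` on ideal classes**, `c ∈ Cl(𝓞_{L⁺})` (base change of §1 on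
classes). [cite: Okazaki2000, §5 Prop. 27 (the map `N : C_K/ιC_{K⁺} → C_k/ιC_{k⁺}`)] [cite: NeukirchANT1999, Ch. III §1 Prop. (1.6)] -/
theorem IsCMField.classGroupNorm_classGroupExtend_eq [Algebra (maximalRealSubfield K) (maximalRealSubfield L)]
    [IsScalarTower (maximalRealSubfield K) (maximalRealSubfield L) L]
    (c : ClassGroup (𝓞 (maximalRealSubfield L))) :
    classGroupNorm K L (classGroupExtend (maximalRealSubfield L) L c) =
      classGroupExtend (maximalRealSubfield K) K
        (classGroupNorm (maximalRealSubfield K) (maximalRealSubfield L) c) := by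
  obtain ⟨⟨𝔟, h𝔟⟩, rfl⟩ := ClassGroup.mk0_surjective c
  rw [classGroupExtend_mk0, classGroupNorm_mk0, classGroupNorm_mk0, classGroupExtend_mk0]
  congr 1
  apply Subtype.ext
  exact IsCMField.relNorm_map_eq_map_relNorm K L 𝔟

/-- The real subfield of `K` maps into the real subfield of `L`. [folklore] -/
private theorem algebraMap_mem_maximalRealSubfield (y : maximalRealSubfield K) :
    algebraMap K L y ∈ maximalRealSubfield L := by
  rw [← complexConj_eq_self_iff, ← algebraMap_complexConj, complexConj_apply_eq_self]

/-- **`N_{L/K}(ι_L(C_{L⁺})) ⊆ ι_K(C_{K⁺})`: the norm map `C_L/ι_LC_{L⁺} → C_K/ι_KC_{K⁺}` is well defined**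
(for every pair of CM fields `K ⊆ L`; the algebra `K⁺ → L⁺` is the restriction of `K → L`).
[cite: Okazaki2000, §5 Prop. 27 (the map `N : C_K/ιC_{K⁺} → C_k/ιC_{k⁺}`)] -/
theorem IsCMField.map_range_classGroupExtend_le :
    ((classGroupExtend (maximalRealSubfield L) L).range).map (classGroupNorm K L) ≤
      (classGroupExtend (maximalRealSubfield K) K).range := by
  rintro _ ⟨_, ⟨c, rfl⟩, rfl⟩
  -- the algebra `K⁺ → L⁺` and the tower `K⁺ → L⁺ → L`
  let f : maximalRealSubfield K →+* maximalRealSubfield L :=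
    ((algebraMap K L).comp (maximalRealSubfield K).subtype).codRestrict (maximalRealSubfield L)
      (fun y => algebraMap_mem_maximalRealSubfield K L y)
  letI : Algebra (maximalRealSubfield K) (maximalRealSubfield L) := f.toAlgebra
  haveI : IsScalarTower (maximalRealSubfield K) (maximalRealSubfield L) L :=
    IsScalarTower.of_algebraMap_eq fun y => rfl
  exact ⟨_, (IsCMField.classGroupNorm_classGroupExtend_eq K L c).symm⟩

end BaseChange

/-! ### §2. `[C_K : ι_K(C_{K⁺})] ∣ [C_K : S] · [C_L : ι_L(C_{L⁺})]`, i.e. `h⁻_K κ_K ∣ 2^r · h⁻_L κ_L` -/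

section QuotientRoute

variable (K L : Type) [Field K] [NumberField K] [IsCMField K] [Field L] [NumberField L] [IsCMField L]
  [Algebra K L]

/-- **`[C_K : ι_K(C_{K⁺})] ∣ [C_K : S] · [C_L : ι_L(C_{L⁺})]`** with `S = N_{L/K}(C_L)·ι_K(C_{K⁺})`: the norm
map induces `C_L/ι_L(C_{L⁺}) ↠ S/ι_K(C_{K⁺})` (§1), and `[C_K : ι_K(C_{K⁺})] = [C_K : S]·[S : ι_K(C_{K⁺})]`
(Okazaki: «`#(C_k/ιC_{k⁺})/2^r` divides `#(C_K/ιC_{K⁺})`»). [cite: Okazaki2000, §5 Cor. 28 (proof)] -/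
theorem IsCMField.index_range_classGroupExtend_dvd :
    (classGroupExtend (maximalRealSubfield K) K).range.index ∣
      ((classGroupNorm K L).range ⊔ (classGroupExtend (maximalRealSubfield K) K).range).index *
        (classGroupExtend (maximalRealSubfield L) L).range.index := by
  set IK := (classGroupExtend (maximalRealSubfield K) K).range with hIK
  set IL := (classGroupExtend (maximalRealSubfield L) L).range with hIL
  -- `f : C_L → C_K → C_K/ι_K(C_{K⁺})`
  set f : ClassGroup (𝓞 L) →* ClassGroup (𝓞 K) ⧸ IK := (QuotientGroup.mk' IK).comp (classGroupNorm K L)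
    with hf
  -- its range is `S/ι_K(C_{K⁺})`, of index `[C_K : S]`
  have hrange : f.range.index = ((classGroupNorm K L).range ⊔ IK).index := by
    rw [hf, MonoidHom.range_comp, Subgroup.index_map, QuotientGroup.ker_mk', QuotientGroup.range_mk',
      Subgroup.index_top, mul_one]
  -- its kernel contains `ι_L(C_{L⁺})` (§1)
  have hker : IL ≤ f.ker := by
    intro x hx
    rw [MonoidHom.mem_ker, hf, MonoidHom.comp_apply, QuotientGroup.mk'_apply, QuotientGroup.eq_one_iff]
    exact IsCMField.map_range_classGroupExtend_le K L ⟨x, hx, rfl⟩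
  -- count
  have h1 : IK.index = Nat.card f.range * f.range.index := by
    rw [Subgroup.index_eq_card IK, f.range.card_mul_index]
  rw [h1, hrange, ← Subgroup.index_ker f, mul_comm]
  exact Nat.mul_dvd_mul_left _ (Subgroup.index_dvd_of_le hker)

/-- **`h⁻_K κ_K ∣ [C_K : S] · h⁻_L κ_L`** for every pair of CM fields `K ⊆ L` (`S = N_{L/K}(C_L)·ι(C_{K⁺})`,
`h⁻_F = h_F/h_{F⁺}`, `κ_F = #ker(C_{F⁺} → C_F)`): the previous divisibility read through formula (4)
`[C_F : ι(C_{F⁺})] = h⁻_F κ_F` — Okazaki's «`h⁻_k` divides `2^r h⁻_K κ_K/κ_k`».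
[cite: Okazaki2000, §5 formula (4) and Cor. 28 (proof)] -/
theorem IsCMField.classNumber_div_mul_card_ker_dvd :
    classNumber K / classNumber (maximalRealSubfield K) *
        Nat.card (classGroupExtend (maximalRealSubfield K) K).ker ∣
      ((classGroupNorm K L).range ⊔ (classGroupExtend (maximalRealSubfield K) K).range).index *
        (classNumber L / classNumber (maximalRealSubfield L) *
          Nat.card (classGroupExtend (maximalRealSubfield L) L).ker) := by
  rw [← IsCMField.index_range_classGroupExtend_eq K, ← IsCMField.index_range_classGroupExtend_eq L]
  exact IsCMField.index_range_classGroupExtend_dvd K L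

/-- **`[C_K : S] = 2^r`** (`S = N_{L/K}(C_L)·ι(C_{K⁺})`): by Prop. 27 the quotient `C_K/S` has exponent
dividing `2`, so it is a `2`-group («let `r` be the `2`-rank of the cokernel in Proposition 27»).
[cite: Okazaki2000, §5 Prop. 27 and Cor. 28 (proof)] -/
theorem IsCMField.exists_index_range_sup_range_eq_two_pow :
    ∃ r : ℕ, ((classGroupNorm K L).range ⊔ (classGroupExtend (maximalRealSubfield K) K).range).index = 2 ^ r := by
  set S := (classGroupNorm K L).range ⊔ (classGroupExtend (maximalRealSubfield K) K).range with hS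
  have h2 : IsPGroup 2 (ClassGroup (𝓞 K) ⧸ S) := by
    intro q
    obtain ⟨c, rfl⟩ := QuotientGroup.mk_surjective q
    refine ⟨1, ?_⟩
    rw [pow_one, ← QuotientGroup.mk_pow, QuotientGroup.eq_one_iff]
    exact IsCMField.sq_mem_range_sup_range K L c
  obtain ⟨r, hr⟩ := IsPGroup.iff_card.mp h2
  exact ⟨r, by rw [Subgroup.index_eq_card, hr]⟩

/-- Hence **`h⁻_K κ_K ∣ 2^r · h⁻_L κ_L` for some `r`** (every pair of CM fields).
[cite: Okazaki2000, §5 Cor. 28 (proof)] -/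
theorem IsCMField.exists_classNumber_div_mul_card_ker_dvd_two_pow_mul :
    ∃ r : ℕ, classNumber K / classNumber (maximalRealSubfield K) *
        Nat.card (classGroupExtend (maximalRealSubfield K) K).ker ∣
      2 ^ r * (classNumber L / classNumber (maximalRealSubfield L) *
        Nat.card (classGroupExtend (maximalRealSubfield L) L).ker) := by
  obtain ⟨r, hr⟩ := IsCMField.exists_index_range_sup_range_eq_two_pow K L
  exact ⟨r, hr ▸ IsCMField.classNumber_div_mul_card_ker_dvd K L⟩

end QuotientRoute

/-! ### §3. «`r ≤ 1` by class field theory»: at most one quadratic subextension ⟹ `[C_K : S] ∣ 2` -/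

section IndexTwo

/-- In a sup with a cyclic group whose generator squares into `M`: `b ∈ M ⊔ ⟨x⟩`, `x² ∈ M` ⟹ `b ∈ M` or
`b x⁻¹ ∈ M`. [folklore] -/
private theorem mem_or_mul_inv_mem_of_mem_sup_zpowers {G : Type*} [CommGroup G] {M : Subgroup G} {x b : G}
    (hx : x ^ 2 ∈ M) (hb : b ∈ M ⊔ Subgroup.zpowers x) : b ∈ M ∨ b * x⁻¹ ∈ M := by
  obtain ⟨m, hm, z, hz, hmz⟩ := Subgroup.mem_sup.mp hb
  obtain ⟨k, rfl⟩ := Subgroup.mem_zpowers_iff.mp hz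
  have hx2 : x ^ (2 : ℤ) ∈ M := by rw [zpow_ofNat]; exact hx
  obtain ⟨q, hq | hq⟩ := Int.even_or_odd' k
  · left
    rw [← hmz, hq, zpow_mul]
    exact mul_mem hm (Subgroup.zpow_mem _ hx2 _)
  · right
    rw [← hmz, hq, zpow_add, zpow_mul, zpow_one, mul_assoc, mul_assoc, mul_inv_cancel, mul_one]
    exact mul_mem hm (Subgroup.zpow_mem _ hx2 _)

/-- **A finite abelian group all of whose squares lie in a subgroup `A`, and `t ∉ A`: there is a subgroup
`M ⊇ A` of index `2` with `t ∉ M`** (a maximal subgroup containing `A` and avoiding `t`; any two elements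
outside it are congruent modulo it).  The group-theoretic half of «`r ≤ 1` by class field theory».
[cite: Okazaki2000, §5 Cor. 28 (proof)] -/
theorem Subgroup.exists_index_two_not_mem_of_sq_mem {G : Type*} [CommGroup G] [Finite G]
    {A : Subgroup G} (hsq : ∀ g : G, g ^ 2 ∈ A) {t : G} (ht : t ∉ A) :
    ∃ M : Subgroup G, A ≤ M ∧ t ∉ M ∧ M.index = 2 := by
  classical
  haveI : Finite (Subgroup G) :=
    Finite.of_injective (fun H : Subgroup G => (H : Set G)) fun _ _ h => SetLike.coe_injective h
  set P : Set (Subgroup G) := {M | A ≤ M ∧ t ∉ M} with hP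
  obtain ⟨M, ⟨hAM, htM⟩, hmax⟩ := (Set.toFinite P).exists_maximal ⟨A, le_rfl, ht⟩
  refine ⟨M, hAM, htM, ?_⟩
  -- `x ∉ M ⟹ t x⁻¹ ∈ M` (maximality: `t ∈ M ⊔ ⟨x⟩ = M ∪ Mx`)
  have key : ∀ x, x ∉ M → t * x⁻¹ ∈ M := by
    intro x hx
    have hP' : ¬ (A ≤ M ⊔ Subgroup.zpowers x ∧ t ∉ M ⊔ Subgroup.zpowers x) := by
      intro h
      have hle : M ⊔ Subgroup.zpowers x ≤ M := hmax h le_sup_left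
      exact hx (hle (Subgroup.mem_sup_right (Subgroup.mem_zpowers x)))
    have htx : t ∈ M ⊔ Subgroup.zpowers x := by
      by_contra h
      exact hP' ⟨hAM.trans le_sup_left, h⟩
    rcases mem_or_mul_inv_mem_of_mem_sup_zpowers (hAM (hsq x)) htx with h | h
    · exact absurd h htM
    · exact h
  rw [Subgroup.index_eq_two_iff]
  refine ⟨t, fun c => ?_⟩
  by_cases hc : c ∈ M
  · refine Or.inr ⟨hc, fun hct => htM ?_⟩
    have h := mul_mem (inv_mem hc) hct
    rwa [inv_mul_cancel_left] at h
  · refine Or.inl ⟨?_, hc⟩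
    have h1 : t * c⁻¹ ∈ M := key c hc
    have h2 : c * t = (t * c⁻¹)⁻¹ * t ^ 2 := by group
    rw [h2]
    exact mul_mem (inv_mem h1) (hAM (hsq t))

/-- If all squares lie in `A` and `[G : A] ∤ 2`, there are two DISTINCT subgroups `M₁ ≠ M₂ ⊇ A` of index
`2`. [cite: Okazaki2000, §5 Cor. 28 (proof)] -/
theorem Subgroup.exists_ne_index_two_of_sq_mem {G : Type*} [CommGroup G] [Finite G]
    {A : Subgroup G} (hsq : ∀ g : G, g ^ 2 ∈ A) (hA : ¬ A.index ∣ 2) :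
    ∃ M₁ M₂ : Subgroup G, A ≤ M₁ ∧ A ≤ M₂ ∧ M₁.index = 2 ∧ M₂.index = 2 ∧ M₁ ≠ M₂ := by
  -- `a ∉ A`
  have hA1 : A ≠ ⊤ := by
    rintro rfl
    exact hA (by rw [Subgroup.index_top]; exact one_dvd 2)
  obtain ⟨a, haA⟩ : ∃ a : G, a ∉ A := by
    by_contra h
    push Not at h
    exact hA1 (Subgroup.eq_top_iff' A |>.mpr h)
  obtain ⟨M₁, hAM₁, haM₁, hM₁⟩ := Subgroup.exists_index_two_not_mem_of_sq_mem hsq haA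
  -- `b ∉ A ⊔ ⟨a⟩` (else `[G : A] = 2`)
  set A₂ := A ⊔ Subgroup.zpowers a with hA₂
  obtain ⟨b, hbA₂⟩ : ∃ b : G, b ∉ A₂ := by
    by_contra h
    push Not at h
    apply hA
    have hidx : A.index = 2 := by
      rw [Subgroup.index_eq_two_iff]
      refine ⟨a, fun c => ?_⟩
      rcases mem_or_mul_inv_mem_of_mem_sup_zpowers (hsq a) (h c) with hc | hc
      · refine Or.inr ⟨hc, fun hca => haA ?_⟩
        have h' := mul_mem (inv_mem hc) hca
        rwa [inv_mul_cancel_left] at h'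
      · refine Or.inl ⟨?_, fun hc' => haA ?_⟩
        · have h' : c * a = c * a⁻¹ * a ^ 2 := by group
          rw [h']
          exact mul_mem hc (hsq a)
        · have h' := mul_mem (inv_mem hc') hc
          rwa [inv_mul_cancel_left, inv_mem_iff] at h'
    rw [hidx]
  have hsq₂ : ∀ g : G, g ^ 2 ∈ A₂ := fun g => Subgroup.mem_sup_left (hsq g)
  obtain ⟨M₂, hAM₂, hbM₂, hM₂⟩ := Subgroup.exists_index_two_not_mem_of_sq_mem hsq₂ hbA₂
  refine ⟨M₁, M₂, hAM₁, le_sup_left.trans hAM₂, hM₁, hM₂, fun h => haM₁ ?_⟩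
  rw [h]
  exact hAM₂ (Subgroup.mem_sup_right (Subgroup.mem_zpowers a))

variable (K L : Type) [Field K] [NumberField K] [IsCMField K] [Field L] [NumberField L] [IsCMField L]
  [Algebra K L]

open hilbertClassField in
omit [IsCMField K] [IsCMField L] in
/-- **Two distinct subgroups `M₁ ≠ M₂ ⊇ N_{L/K}(C_L)` of index `2` in `C_K` give two distinct quadratic
extensions of `K` inside `L`**: their class fields `F_{M_i} ⊆ H_K` are quadratic over `K`
(`[F_M : K] = [C_K : M]`), embed into `L` over `K` (norm limitation), and equal images in `L` would make
`F_{M₁} ≃_K F_{M₂}`, hence `F_{M₁} = F_{M₂}` (both are normal over `K` inside `K̄`) and `M₁ = M₂`.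
[cite: Okazaki2000, §5 Cor. 28 (proof, «by class field theory»)] [cite: Cox2013, §5.C Cor. 5.24] -/
theorem exists_ne_intermediateField_finrank_eq_two {M₁ M₂ : Subgroup (ClassGroup (𝓞 K))}
    (h₁ : (classGroupNorm K L).range ≤ M₁) (h₂ : (classGroupNorm K L).range ≤ M₂)
    (hM₁ : M₁.index = 2) (hM₂ : M₂.index = 2) (hne : M₁ ≠ M₂) :
    ∃ E₁ E₂ : IntermediateField K L,
      Module.finrank K E₁ = 2 ∧ Module.finrank K E₂ = 2 ∧ E₁ ≠ E₂ := by
  -- the embeddings `F_{M_i} → L`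
  have emb : ∀ M : Subgroup (ClassGroup (𝓞 K)), (classGroupNorm K L).range ≤ M →
      Nonempty (classFieldOfSubgroup K M →ₐ[K] L) := fun M hM => by
    obtain ⟨ψ⟩ := nonempty_algHom_fixedField_galSubgroup K L M hM
    exact ⟨ψ.comp (IntermediateField.liftAlgEquiv
      (IntermediateField.fixedField (galSubgroup K M))).symm.toAlgHom⟩
  obtain ⟨ψ₁⟩ := emb M₁ h₁
  obtain ⟨ψ₂⟩ := emb M₂ h₂
  -- degrees of the images
  have hdeg : ∀ (M : Subgroup (ClassGroup (𝓞 K))) (ψ : classFieldOfSubgroup K M →ₐ[K] L),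
      Module.finrank K ψ.fieldRange = M.index := fun M ψ => by
    rw [← finrank_classFieldOfSubgroup K M, ← IntermediateField.finrank_eq_finrank_subalgebra,
      AlgHom.fieldRange_toSubalgebra, ← (AlgEquiv.ofInjectiveField ψ).toLinearEquiv.finrank_eq]
  refine ⟨ψ₁.fieldRange, ψ₂.fieldRange, (hdeg M₁ ψ₁).trans hM₁, (hdeg M₂ ψ₂).trans hM₂, fun heq => hne ?_⟩
  -- equal images: `F_{M₁} ≃_K F_{M₂}`, so `F_{M₁} = F_{M₂}` in `K̄` (normality) and `M₁ = M₂`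
  have hr : ψ₁.range = ψ₂.range := by
    rw [← AlgHom.fieldRange_toSubalgebra, ← AlgHom.fieldRange_toSubalgebra, heq]
  let θ : classFieldOfSubgroup K M₁ ≃ₐ[K] classFieldOfSubgroup K M₂ :=
    ((AlgEquiv.ofInjectiveField ψ₁).trans (Subalgebra.equivOfEq _ _ hr)).trans
      (AlgEquiv.ofInjectiveField ψ₂).symm
  let g : classFieldOfSubgroup K M₁ →ₐ[K] AlgebraicClosure K :=
    (classFieldOfSubgroup K M₂).val.comp θ.toAlgHom
  have hg1 : g.fieldRange = classFieldOfSubgroup K M₁ := AlgHom.fieldRange_of_normal g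
  have hg2 : g.fieldRange = classFieldOfSubgroup K M₂ := by
    apply le_antisymm
    · rintro _ ⟨y, rfl⟩
      exact (θ y).2
    · intro x hx
      exact ⟨θ.symm ⟨x, hx⟩, by simp [g]⟩
  exact classFieldOfSubgroup_injective K (hg1.symm.trans hg2)

/-- **«The assumption … implies `r ≤ 1` by class field theory»: if `L` contains at most one quadratic
extension of `K`, then `[C_K : N_{L/K}(C_L)·ι(C_{K⁺})] ∣ 2`** (`C_K/S` has exponent `2` by Prop. 27; if
`[C_K : S] ∤ 2` there are two index-`2` subgroups above `S`, hence two quadratic subextensions of `L/K`).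
[cite: Okazaki2000, §5 Cor. 28 (proof)] -/
theorem IsCMField.index_range_sup_range_dvd_two
    (h1 : ∀ E₁ E₂ : IntermediateField K L, Module.finrank K E₁ = 2 → Module.finrank K E₂ = 2 → E₁ = E₂) :
    ((classGroupNorm K L).range ⊔ (classGroupExtend (maximalRealSubfield K) K).range).index ∣ 2 := by
  by_contra hS
  obtain ⟨M₁, M₂, hSM₁, hSM₂, hM₁, hM₂, hne⟩ :=
    Subgroup.exists_ne_index_two_of_sq_mem (IsCMField.sq_mem_range_sup_range K L) hS
  obtain ⟨E₁, E₂, hE₁, hE₂, hE⟩ := exists_ne_intermediateField_finrank_eq_two K L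
    (le_sup_left.trans hSM₁) (le_sup_left.trans hSM₂) hM₁ hM₂ hne
  exact hE (h1 E₁ E₂ hE₁ hE₂)

end IndexTwo

/-! ### §4. Corollary 28 -/

section Corollary28

variable (K L : Type) [Field K] [NumberField K] [IsCMField K] [Field L] [NumberField L] [IsCMField L]
  [Algebra K L]

/-- Under «at most one quadratic extension of `K` inside `L`»: **`h⁻_K κ_K ∣ 2 · h⁻_L κ_L`**.
[cite: Okazaki2000, §5 Cor. 28 (proof)] -/
theorem IsCMField.classNumber_div_mul_card_ker_dvd_two_mul
    (h1 : ∀ E₁ E₂ : IntermediateField K L, Module.finrank K E₁ = 2 → Module.finrank K E₂ = 2 → E₁ = E₂) :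
    classNumber K / classNumber (maximalRealSubfield K) *
        Nat.card (classGroupExtend (maximalRealSubfield K) K).ker ∣
      2 * (classNumber L / classNumber (maximalRealSubfield L) *
        Nat.card (classGroupExtend (maximalRealSubfield L) L).ker) :=
  (IsCMField.classNumber_div_mul_card_ker_dvd K L).trans
    (Nat.mul_dvd_mul_right (IsCMField.index_range_sup_range_dvd_two K L h1) _)

/-- **Okazaki's Corollary 28, first assertion: if `L` contains at most one quadratic extension of `K`
then `h⁻_K ∣ 4 h⁻_L`** (`h⁻_F = h_F/h_{F⁺}`; `κ_L ≤ 2` by Lemma 14). [cite: Okazaki2000, §5 Cor. 28] -/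
theorem IsCMField.classNumber_div_dvd_four_mul
    (h1 : ∀ E₁ E₂ : IntermediateField K L, Module.finrank K E₁ = 2 → Module.finrank K E₂ = 2 → E₁ = E₂) :
    classNumber K / classNumber (maximalRealSubfield K) ∣
      4 * (classNumber L / classNumber (maximalRealSubfield L)) := by
  have h := IsCMField.classNumber_div_mul_card_ker_dvd_two_mul K L h1
  have hκL := card_ker_classGroupExtend_le_two L
  have hy : 0 < Nat.card (classGroupExtend (maximalRealSubfield L) L).ker := Nat.card_pos
  set a := classNumber K / classNumber (maximalRealSubfield K)
  set b := classNumber L / classNumber (maximalRealSubfield L)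
  set x := Nat.card (classGroupExtend (maximalRealSubfield K) K).ker
  set y := Nat.card (classGroupExtend (maximalRealSubfield L) L).ker
  have h2 : a ∣ 2 * (b * y) := (Dvd.intro x rfl).trans h
  have h3 : 2 * (b * y) ∣ 4 * b := by
    interval_cases y
    · exact ⟨2, by ring⟩
    · exact ⟨1, by ring⟩
  exact h2.trans h3

/-- **Okazaki's Corollary 28, second assertion: if moreover `κ_L ∣ κ_K` then `h⁻_K ∣ 2 h⁻_L`.**
[cite: Okazaki2000, §5 Cor. 28] -/
theorem IsCMField.classNumber_div_dvd_two_mul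
    (h1 : ∀ E₁ E₂ : IntermediateField K L, Module.finrank K E₁ = 2 → Module.finrank K E₂ = 2 → E₁ = E₂)
    (hκ : Nat.card (classGroupExtend (maximalRealSubfield L) L).ker ∣
      Nat.card (classGroupExtend (maximalRealSubfield K) K).ker) :
    classNumber K / classNumber (maximalRealSubfield K) ∣
      2 * (classNumber L / classNumber (maximalRealSubfield L)) := by
  have h := IsCMField.classNumber_div_mul_card_ker_dvd_two_mul K L h1
  have hκK : 0 < Nat.card (classGroupExtend (maximalRealSubfield K) K).ker := Nat.card_pos
  set a := classNumber K / classNumber (maximalRealSubfield K)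
  set b := classNumber L / classNumber (maximalRealSubfield L)
  set x := Nat.card (classGroupExtend (maximalRealSubfield K) K).ker
  set y := Nat.card (classGroupExtend (maximalRealSubfield L) L).ker
  have h2 : a * x ∣ 2 * b * x :=
    h.trans (by rw [mul_assoc]; exact Nat.mul_dvd_mul_left 2 (Nat.mul_dvd_mul_left b hκ))
  exact Nat.dvd_of_mul_dvd_mul_right hκK h2

/-- Cor. 28 with `[C_K : S]` kept symbolic: **`h⁻_K ∣ 2 · [C_K : S] · h⁻_L`** for every pair of CM fields
(`κ_K ≥ 1`, `κ_L ≤ 2`), `[C_K : S] = 2^r`. [cite: Okazaki2000, §5 Cor. 28 (proof) and Lemma 14] -/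
theorem IsCMField.classNumber_div_dvd_two_mul_index_mul :
    classNumber K / classNumber (maximalRealSubfield K) ∣
      2 * ((classGroupNorm K L).range ⊔ (classGroupExtend (maximalRealSubfield K) K).range).index *
        (classNumber L / classNumber (maximalRealSubfield L)) := by
  have h := IsCMField.classNumber_div_mul_card_ker_dvd K L
  have hκL := card_ker_classGroupExtend_le_two L
  have hy : 0 < Nat.card (classGroupExtend (maximalRealSubfield L) L).ker := Nat.card_pos
  set a := classNumber K / classNumber (maximalRealSubfield K)
  set b := classNumber L / classNumber (maximalRealSubfield L)
  set s := ((classGroupNorm K L).range ⊔ (classGroupExtend (maximalRealSubfield K) K).range).index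
  set x := Nat.card (classGroupExtend (maximalRealSubfield K) K).ker
  set y := Nat.card (classGroupExtend (maximalRealSubfield L) L).ker
  have h2 : a ∣ s * (b * y) := (Dvd.intro x rfl).trans h
  have h3 : s * (b * y) ∣ 2 * s * b := by
    interval_cases y
    · exact ⟨2, by ring⟩
    · exact ⟨1, by ring⟩
  exact h2.trans h3

end Corollary28

/-! ### §5. Okazaki's Theorem 1 for quadratic extensions of CM fields; Corollary 2 for quartic CM fields -/

section TheoremOneDegreeTwo

variable (K L : Type) [Field K] [NumberField K] [IsCMField K] [Field L] [NumberField L] [IsCMField L]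
  [Algebra K L]

omit [IsCMField K] [IsCMField L] in
/-- In an extension `L/K` of degree `2` the only intermediate field of degree `2` over `K` is `L`: «at most one
quadratic extension of `K` inside `L`». [folklore] -/
private theorem intermediateField_eq_of_finrank_eq_two (h2 : Module.finrank K L = 2) (E₁ E₂ : IntermediateField K L)
    (hE₁ : Module.finrank K E₁ = 2) (hE₂ : Module.finrank K E₂ = 2) : E₁ = E₂ := by
  haveI : FiniteDimensional K L := Module.finite_of_finrank_eq_succ h2
  have htop : Module.finrank K (⊤ : IntermediateField K L) = 2 := by rw [IntermediateField.finrank_top', h2]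
  have h₁ : E₁ = ⊤ := IntermediateField.eq_of_le_of_finrank_eq le_top (by rw [hE₁, htop])
  have h₂ : E₂ = ⊤ := IntermediateField.eq_of_le_of_finrank_eq le_top (by rw [hE₂, htop])
  rw [h₁, h₂]

/-- **Okazaki's Theorem 1 («Let `k ⊂ K` be two CM-fields.  Then `h⁻_k ∣ 4h⁻_K`») in the case `[K : k] = 2`**:
a quadratic extension contains exactly one quadratic subextension, so Corollary 28 applies.
[cite: Okazaki2000, Theorem 1 (the case [K : k] = 2) and §5 Cor. 28] -/
theorem IsCMField.classNumber_div_dvd_four_mul_of_finrank_eq_two (h2 : Module.finrank K L = 2) :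
    classNumber K / classNumber (maximalRealSubfield K) ∣
      4 * (classNumber L / classNumber (maximalRealSubfield L)) :=
  IsCMField.classNumber_div_dvd_four_mul K L (intermediateField_eq_of_finrank_eq_two K L h2)

/-- The same with `κ`: **`[K : k] = 2` and `κ_K ∣ κ_k` ⟹ `h⁻_k ∣ 2h⁻_K`** (Cor. 28, second assertion).
[cite: Okazaki2000, §5 Cor. 28 (the case [K : k] = 2)] -/
theorem IsCMField.classNumber_div_dvd_two_mul_of_finrank_eq_two (h2 : Module.finrank K L = 2)
    (hκ : Nat.card (classGroupExtend (maximalRealSubfield L) L).ker ∣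
      Nat.card (classGroupExtend (maximalRealSubfield K) K).ker) :
    classNumber K / classNumber (maximalRealSubfield K) ∣
      2 * (classNumber L / classNumber (maximalRealSubfield L)) :=
  IsCMField.classNumber_div_dvd_two_mul K L (intermediateField_eq_of_finrank_eq_two K L h2) hκ

omit [IsCMField L] in
/-- A CM field of absolute degree `2` (an imaginary quadratic field) has `h_{K⁺} = 1` (`K⁺ = ℚ`). [folklore] -/
private theorem classNumber_maximalRealSubfield_eq_one_of_finrank_eq_two' (hK : Module.finrank ℚ K = 2) :
    classNumber (maximalRealSubfield K) = 1 := by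
  have h1 : Module.finrank ℚ (maximalRealSubfield K) = 1 := by
    have h := Module.finrank_mul_finrank ℚ (maximalRealSubfield K) K
    rw [Algebra.IsQuadraticExtension.finrank_eq_two (maximalRealSubfield K) K, hK] at h
    omega
  have e : maximalRealSubfield K ≃ₐ[ℚ] ℚ :=
    (Subalgebra.topEquiv.symm.trans (Subalgebra.equivOfEq _ _
      (Subalgebra.bot_eq_top_iff_finrank_eq_one.mpr h1).symm)).trans
      (Algebra.botEquiv ℚ (maximalRealSubfield K))
  unfold classNumber
  rw [Fintype.card_congr (ClassGroup.mulEquiv (RingOfIntegers.mapRingEquiv e.toRingEquiv)).toEquiv]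
  exact Rat.classNumber_eq

/-- **Theorem 1 for an imaginary quadratic field `k` inside a quartic CM field `K`: `h_k ∣ 4h⁻_K`**
(`[K : k] = 2`, `h⁻_k = h_k`). [cite: Okazaki2000, Theorem 1 and Cor. 2 (the case [K : ℚ] = 4)] -/
theorem IsCMField.classNumber_dvd_four_mul_classNumber_div_of_finrank_eq_two (hK : Module.finrank ℚ K = 2)
    (hL : Module.finrank ℚ L = 4) :
    classNumber K ∣ 4 * (classNumber L / classNumber (maximalRealSubfield L)) := by
  have h2 : Module.finrank K L = 2 := by
    have h := Module.finrank_mul_finrank ℚ K L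
    rw [hK, hL] at h
    omega
  have h := IsCMField.classNumber_div_dvd_four_mul_of_finrank_eq_two K L h2
  rwa [classNumber_maximalRealSubfield_eq_one_of_finrank_eq_two' K hK, Nat.div_one] at h

/-- **Okazaki's Corollary 2 («Let `k` be an imaginary quadratic field contained in a CM-field `K` whose relative
class number is `1`.  Then `h_k = 1, 2` or `4`») in the case `[K : ℚ] = 4`.**
[cite: Okazaki2000, Cor. 2 (the case [K : ℚ] = 4)] -/
theorem IsCMField.classNumber_eq_of_finrank_eq_two_of_classNumber_div_eq_one (hK : Module.finrank ℚ K = 2)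
    (hL : Module.finrank ℚ L = 4) (h1 : classNumber L / classNumber (maximalRealSubfield L) = 1) :
    classNumber K = 1 ∨ classNumber K = 2 ∨ classNumber K = 4 := by
  have h := IsCMField.classNumber_dvd_four_mul_classNumber_div_of_finrank_eq_two K L hK hL
  rw [h1, mul_one] at h
  have hle := Nat.le_of_dvd four_pos h
  interval_cases hc : classNumber K
  · exact absurd h (by decide)
  · exact Or.inl rfl
  · exact Or.inr (Or.inl rfl)
  · exact absurd h (by decide)
  · exact Or.inr (Or.inr rfl)

end TheoremOneDegreeTwo

/-! ### §6. Okazaki's Theorem 1 for cyclic extensions of CM fields -/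

section TheoremOneCyclic

/-- **A finite cyclic group has at most one subgroup of index `2`** (it is `⟨g²⟩` for a generator `g`:
`#⟨g²⟩ = ord(g)/gcd(ord g, 2)`, so `[G : ⟨g²⟩] = gcd(#G, 2) ≤ 2`, and `⟨g²⟩ ≤ H` for every `H` of index `2`).
[folklore] -/
private theorem Subgroup.eq_of_index_eq_two_of_isCyclic {G : Type*} [Group G] [Finite G] [IsCyclic G]
    {H₁ H₂ : Subgroup G} (h₁ : H₁.index = 2) (h₂ : H₂.index = 2) : H₁ = H₂ := by
  obtain ⟨g, hg⟩ := IsCyclic.exists_generator (α := G)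
  set S : Subgroup G := Subgroup.zpowers (g ^ 2) with hS
  have hn : 0 < Nat.card G := Nat.card_pos
  -- `#S · [G : S] = #G`, `#S = #G / gcd(#G, 2)`
  have hcardS : Nat.card S = Nat.card G / Nat.gcd (Nat.card G) 2 := by
    rw [hS, Nat.card_zpowers, orderOf_pow' g two_ne_zero, orderOf_eq_card_of_forall_mem_zpowers hg]
  have hSindex : S.index = Nat.gcd (Nat.card G) 2 := by
    have hmul := S.card_mul_index
    have hd : Nat.gcd (Nat.card G) 2 ∣ Nat.card G := Nat.gcd_dvd_left _ _
    have hdpos : 0 < Nat.gcd (Nat.card G) 2 := Nat.gcd_pos_of_pos_left _ hn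
    have hq : 0 < Nat.card G / Nat.gcd (Nat.card G) 2 := Nat.div_pos (Nat.le_of_dvd hn hd) hdpos
    rw [hcardS] at hmul
    have h2 : Nat.card G / Nat.gcd (Nat.card G) 2 * S.index =
        Nat.card G / Nat.gcd (Nat.card G) 2 * Nat.gcd (Nat.card G) 2 := by
      rw [hmul, Nat.div_mul_cancel hd]
    exact Nat.eq_of_mul_eq_mul_left hq h2
  have hSle2 : S.index ≤ 2 := hSindex ▸ Nat.gcd_le_right _ two_pos
  have key : ∀ H : Subgroup G, H.index = 2 → H = S := by
    intro H hH
    have hle : S ≤ H := by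
      rw [hS, Subgroup.zpowers_le, pow_two]
      exact Subgroup.mul_self_mem_of_index_two hH g
    have hdvd : H.index ∣ S.index := Subgroup.index_dvd_of_le hle
    rw [hH] at hdvd
    have hS2 : S.index = 2 := by
      have hne : S.index ≠ 0 := Subgroup.index_ne_zero_of_finite
      obtain ⟨c, hc⟩ := hdvd
      interval_cases hi : S.index
      · exact absurd rfl hne
      · omega
      · rfl
    have hrel := Subgroup.relIndex_mul_index hle
    rw [hH, hS2] at hrel
    have hrel1 : S.relIndex H = 1 := by omega
    exact le_antisymm (Subgroup.relIndex_eq_one.mp hrel1) hle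
  rw [key H₁ h₁, key H₂ h₂]

/-- **A finite cyclic Galois extension has at most one intermediate field of degree `2`** (Galois correspondence:
`[E : K] = [Gal : Gal(L/E)]`). [folklore] -/
private theorem IntermediateField.eq_of_finrank_eq_two_of_isCyclic {K L : Type*} [Field K] [Field L] [Algebra K L]
    [FiniteDimensional K L] [IsGalois K L] [IsCyclic (L ≃ₐ[K] L)] (E₁ E₂ : IntermediateField K L)
    (h₁ : Module.finrank K E₁ = 2) (h₂ : Module.finrank K E₂ = 2) : E₁ = E₂ := by
  have i₁ : E₁.fixingSubgroup.index = 2 := by rw [← IntermediateField.finrank_eq_fixingSubgroup_index]; exact h₁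
  have i₂ : E₂.fixingSubgroup.index = 2 := by rw [← IntermediateField.finrank_eq_fixingSubgroup_index]; exact h₂
  have heq := Subgroup.eq_of_index_eq_two_of_isCyclic i₁ i₂
  calc E₁ = IntermediateField.fixedField E₁.fixingSubgroup := (IsGalois.fixedField_fixingSubgroup E₁).symm
    _ = IntermediateField.fixedField E₂.fixingSubgroup := by rw [heq]
    _ = E₂ := IsGalois.fixedField_fixingSubgroup E₂

variable (K L : Type) [Field K] [NumberField K] [IsCMField K] [Field L] [NumberField L] [IsCMField L]
  [Algebra K L]

/-- **Okazaki's Theorem 1 («`h⁻_k ∣ 4h⁻_K`») for a CYCLIC Galois extension `K/k` of CM fields** (any degree): a cyclic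
extension contains at most one quadratic subextension of its base, so Corollary 28 applies.
[cite: Okazaki2000, Theorem 1 (the case K/k cyclic) and §5 Cor. 28] -/
theorem IsCMField.classNumber_div_dvd_four_mul_of_isCyclic [IsGalois K L] [IsCyclic (L ≃ₐ[K] L)] :
    classNumber K / classNumber (maximalRealSubfield K) ∣
      4 * (classNumber L / classNumber (maximalRealSubfield L)) := by
  haveI : FiniteDimensional K L := Module.Finite.of_restrictScalars_finite ℚ K L
  exact IsCMField.classNumber_div_dvd_four_mul K L
    (fun E₁ E₂ h₁ h₂ => IntermediateField.eq_of_finrank_eq_two_of_isCyclic E₁ E₂ h₁ h₂)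

/-- The same with `κ`: **`K/k` cyclic and `κ_K ∣ κ_k` ⟹ `h⁻_k ∣ 2h⁻_K`** (Cor. 28, second assertion).
[cite: Okazaki2000, §5 Cor. 28 (the case K/k cyclic)] -/
theorem IsCMField.classNumber_div_dvd_two_mul_of_isCyclic [IsGalois K L] [IsCyclic (L ≃ₐ[K] L)]
    (hκ : Nat.card (classGroupExtend (maximalRealSubfield L) L).ker ∣
      Nat.card (classGroupExtend (maximalRealSubfield K) K).ker) :
    classNumber K / classNumber (maximalRealSubfield K) ∣
      2 * (classNumber L / classNumber (maximalRealSubfield L)) := by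
  haveI : FiniteDimensional K L := Module.Finite.of_restrictScalars_finite ℚ K L
  exact IsCMField.classNumber_div_dvd_two_mul K L
    (fun E₁ E₂ h₁ h₂ => IntermediateField.eq_of_finrank_eq_two_of_isCyclic E₁ E₂ h₁ h₂) hκ

end TheoremOneCyclic

end Literature.NumberTheory.NumberFields

end
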